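import Literature.AlgebraicGeometry.Morphisms.FormalModuleTower
import HarnessLib

/-!
# The completion `M ↦ (M/aⁿ⁺¹M)_n` of an `𝒪_X`-module as a formal tower (quotient model)

Görtz–Wedhorn, *Algebraic Geometry II* (2023), (24.18.1)–(24.18.4) and Rem. 24.87 (pp. 561–563): the
completion `ℱ ↦ ℱ_{/Z} = (ℱ/𝒥ⁿ⁺¹ℱ)_n` along `Z = V(𝒥)`. For `𝒥 = (a)` principal, generated by a
global function `a`, and in the tower language of `Morphisms/FormalModuleTower`:

* `cmplTower a M : ℕᵒᵖ ⥤ Mod(𝒪_X)` — the tower `n ↦ M/aⁿ⁺¹M` with the quotient maps as transitions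
  (`cmplπ`, `cmplStep`, `cmplπ_cmplStep`);
* `isFormalTower_cmplTower` — **it is a formal tower** (`aⁿ⁺¹` kills `M/aⁿ⁺¹M`, the transitions are
  epimorphisms, and `(M/aⁿ⁺²M)/aⁿ⁺¹ = M/aⁿ⁺¹M`), with coherent levels for `M` coherent
  (`coh_cmplTower`);
* `cmplMap a φ : cmplTower a M → cmplTower a N` — functoriality (`cmplπ_cmplMap_app`), `cmplMap_id`,
  `cmplMap_comp`; the completion FUNCTOR `cmpl a : Mod(𝒪_X) ⥤ (ℕᵒᵖ ⥤ Mod(𝒪_X))`.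

A coherent formal module (a formal tower of coherent modules) is ALGEBRAIZABLE when it is isomorphic
to `cmplTower a F` for a coherent `F` (Def. 24.93); Thm. 24.94 says every one is, for `X` proper over
an `a`-adically complete noetherian ring. Everything here is proved; no named facts.

## References

* U. Görtz, T. Wedhorn, *Algebraic Geometry II: Cohomology of Schemes*, Springer Spektrum (2023),
  (24.18.1)–(24.18.4), Rem. 24.87, Def. 24.93 (pp. 561–566). [GortzWedhorn2023]
* A. Grothendieck, EGA III₁ (1961), 5.1. [EGAIII1]
-/

noncomputable section

open CategoryTheory AlgebraicGeometry Limits TopologicalSpace Opposite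
open Literature.AlgebraicGeometry.Modules

universe u

namespace Literature.AlgebraicGeometry.Morphisms

variable {X : Scheme.{u}} (a : Γ(X, ⊤))

section Object

variable (M : X.Modules)

/-- The level `M/aⁿ⁺¹M` of the completion. [cite: GortzWedhorn2023, (24.18.1) (p. 562)] -/
abbrev cmplObj (n : ℕ) : X.Modules := cokernel (globalScalar M (a ^ (n + 1)))

/-- The quotient map `M → M/aⁿ⁺¹M`. [folklore] -/
abbrev cmplπ (n : ℕ) : M ⟶ cmplObj a M n := cokernel.π _

/-- `aⁿ⁺²` followed by `M → M/aⁿ⁺¹M` vanishes. [folklore] -/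
theorem globalScalar_pow_succ_comp_cmplπ (n : ℕ) :
    globalScalar M (a ^ (n + 1 + 1)) ≫ cmplπ a M n = 0 := by
  have h : globalScalar M (a ^ (n + 1)) ≫ cmplπ a M n = 0 := cokernel.condition _
  rw [pow_succ, globalScalar_mul, Category.assoc, h, comp_zero]

/-- The transition map `M/aⁿ⁺²M → M/aⁿ⁺¹M`. [cite: GortzWedhorn2023, (24.18.1) (p. 562)] -/
def cmplStep (n : ℕ) : cmplObj a M (n + 1) ⟶ cmplObj a M n :=
  cokernel.desc _ (cmplπ a M n) (globalScalar_pow_succ_comp_cmplπ a M n)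

/-- `M → M/aⁿ⁺²M → M/aⁿ⁺¹M` is the quotient map. [folklore] -/
@[reassoc (attr := simp)]
theorem cmplπ_cmplStep (n : ℕ) : cmplπ a M (n + 1) ≫ cmplStep a M n = cmplπ a M n :=
  cokernel.π_desc _ _ _

/-- The transition maps are epimorphisms. [folklore] -/
instance epi_cmplStep (n : ℕ) : Epi (cmplStep a M n) :=
  epi_of_epi_fac (cmplπ_cmplStep a M n)

/-- `aⁿ⁺¹` kills `M/aⁿ⁺¹M`. [folklore] -/
theorem globalScalar_cmplObj_eq_zero (n : ℕ) : globalScalar (cmplObj a M n) (a ^ (n + 1)) = 0 := by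
  rw [← cancel_epi (cmplπ a M n), ← globalScalar_comp, cokernel.condition, comp_zero]

/-- `aⁿ⁺¹` followed by the transition `M/aⁿ⁺²M → M/aⁿ⁺¹M` vanishes. [folklore] -/
theorem globalScalar_comp_cmplStep (n : ℕ) :
    globalScalar (cmplObj a M (n + 1)) (a ^ (n + 1)) ≫ cmplStep a M n = 0 := by
  rw [globalScalar_comp, globalScalar_cmplObj_eq_zero, comp_zero]

/-- **`(M/aⁿ⁺²M)/aⁿ⁺¹ ≅ M/aⁿ⁺¹M`.** [cite: GortzWedhorn2023, (24.18.2) (p. 562)] -/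
def cmplIso (n : ℕ) : cokernel (globalScalar (cmplObj a M (n + 1)) (a ^ (n + 1))) ≅ cmplObj a M n where
  hom := cokernel.desc _ (cmplStep a M n) (globalScalar_comp_cmplStep a M n)
  inv := cokernel.desc _ (cmplπ a M (n + 1) ≫ cokernel.π _) (by
    rw [globalScalar_comp_assoc, cokernel.condition, comp_zero])
  hom_inv_id := by
    rw [← cancel_epi (cokernel.π _), cokernel.π_desc_assoc, Category.comp_id,
      ← cancel_epi (cmplπ a M (n + 1)), cmplπ_cmplStep_assoc]
    exact cokernel.π_desc _ _ _
  inv_hom_id := by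
    rw [← cancel_epi (cokernel.π _), cokernel.π_desc_assoc, Category.assoc, cokernel.π_desc,
      cmplπ_cmplStep, Category.comp_id]

/-- The quotient map followed by `cmplIso` is the transition map. [folklore] -/
@[reassoc (attr := simp)]
theorem π_cmplIso_hom (n : ℕ) : cokernel.π _ ≫ (cmplIso a M n).hom = cmplStep a M n :=
  cokernel.π_desc _ _ _

/-- **The completion tower `n ↦ M/aⁿ⁺¹M`.** [cite: GortzWedhorn2023, (24.18.1) (p. 562)] -/
def cmplTower : ℕᵒᵖ ⥤ X.Modules :=
  towerOfIsos a (cmplObj a M) (cmplIso a M)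

/-- The levels of the completion tower. [folklore] -/
@[simp]
theorem cmplTower_obj (n : ℕ) : (cmplTower a M).obj ⟨n⟩ = cmplObj a M n := rfl

/-- The transition maps of the completion tower. [folklore] -/
theorem towerπ_cmplTower (n : ℕ) : towerπ (cmplTower a M) n = cmplStep a M n :=
  (towerπ_towerOfIsos a _ _ n).trans (π_cmplIso_hom a M n)

/-- **The completion tower is a formal tower.** [cite: GortzWedhorn2023, (24.18.1)–(24.18.2) (p. 562)] -/
theorem isFormalTower_cmplTower : IsFormalTower a (cmplTower a M) :=
  IsFormalTower.ofIsos a _ _ (globalScalar_cmplObj_eq_zero a M)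

/-- The levels of the completion of a coherent module are coherent (locally noetherian `X`).
[cite: Hartshorne1977, II Prop. 5.7 (p. 114)] -/
theorem coh_cmplTower [IsLocallyNoetherian X] {N : X.Modules} (hN : Coh N) (n : ℕ) :
    Coh ((cmplTower a N).obj ⟨n⟩) :=
  Coh.cokernel _ hN hN

end Object

/-! ### Functoriality -/

section Map

variable {M N P : X.Modules}

/-- The level-`n` component `M/aⁿ⁺¹M → N/aⁿ⁺¹N` of the completion of `φ`. [folklore] -/
abbrev cmplMapApp (φ : M ⟶ N) (n : ℕ) : cmplObj a M n ⟶ cmplObj a N n :=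
  cokernel.map _ _ φ φ (globalScalar_comp φ _)

/-- Compatibility with the quotient maps. [folklore] -/
@[reassoc (attr := simp)]
theorem cmplπ_cmplMapApp (φ : M ⟶ N) (n : ℕ) : cmplπ a M n ≫ cmplMapApp a φ n = φ ≫ cmplπ a N n :=
  cokernel.π_desc _ _ _

/-- Compatibility of the components with the transition maps. [folklore] -/
@[reassoc]
theorem cmplStep_cmplMapApp (φ : M ⟶ N) (n : ℕ) :
    cmplStep a M n ≫ cmplMapApp a φ n = cmplMapApp a φ (n + 1) ≫ cmplStep a N n := by
  rw [← cancel_epi (cmplπ a M (n + 1)), cmplπ_cmplStep_assoc, cmplπ_cmplMapApp,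
    cmplπ_cmplMapApp_assoc, cmplπ_cmplStep]

/-- `cmplMapApp` of the identity. [folklore] -/
theorem cmplMapApp_id (n : ℕ) : cmplMapApp a (𝟙 M) n = 𝟙 _ := by
  rw [← cancel_epi (cmplπ a M n), cmplπ_cmplMapApp, Category.id_comp, Category.comp_id]

/-- `cmplMapApp` of a composite. [folklore] -/
theorem cmplMapApp_comp (φ : M ⟶ N) (ψ : N ⟶ P) (n : ℕ) :
    cmplMapApp a (φ ≫ ψ) n = cmplMapApp a φ n ≫ cmplMapApp a ψ n := by
  rw [← cancel_epi (cmplπ a M n), cmplπ_cmplMapApp, cmplπ_cmplMapApp_assoc, cmplπ_cmplMapApp,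
    Category.assoc]

/-- **The completion of a morphism**, `cmplTower a M → cmplTower a N`. [cite: GortzWedhorn2023, (24.18.1) (p. 562)] -/
def cmplMap (φ : M ⟶ N) : cmplTower a M ⟶ cmplTower a N :=
  NatTrans.ofOpSequence (fun n => cmplMapApp a φ n) fun n => by
    change towerπ (cmplTower a M) n ≫ cmplMapApp a φ n =
      cmplMapApp a φ (n + 1) ≫ towerπ (cmplTower a N) n
    rw [towerπ_cmplTower, towerπ_cmplTower]
    exact cmplStep_cmplMapApp a φ n

/-- The components of `cmplMap`. [folklore] -/
@[simp]
theorem cmplMap_app (φ : M ⟶ N) (n : ℕ) : (cmplMap a φ).app ⟨n⟩ = cmplMapApp a φ n := rfl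

/-- `cmplMap` of the identity. [folklore] -/
theorem cmplMap_id : cmplMap a (𝟙 M) = 𝟙 _ := by
  refine NatTrans.ext (funext fun k => ?_)
  obtain ⟨n⟩ := k
  change cmplMapApp a (𝟙 M) n = 𝟙 (cmplObj a M n)
  exact cmplMapApp_id a n

/-- `cmplMap` of a composite. [folklore] -/
theorem cmplMap_comp (φ : M ⟶ N) (ψ : N ⟶ P) : cmplMap a (φ ≫ ψ) = cmplMap a φ ≫ cmplMap a ψ := by
  refine NatTrans.ext (funext fun k => ?_)
  obtain ⟨n⟩ := k
  change cmplMapApp a (φ ≫ ψ) n = cmplMapApp a φ n ≫ cmplMapApp a ψ n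
  exact cmplMapApp_comp a φ ψ n

end Map

/-- **The completion functor `M ↦ (M/aⁿ⁺¹M)_n`.** [cite: GortzWedhorn2023, (24.18.4) (p. 563)] -/
@[simps obj map]
def cmpl : X.Modules ⥤ ℕᵒᵖ ⥤ X.Modules where
  obj M := cmplTower a M
  map φ := cmplMap a φ
  map_id _ := cmplMap_id a
  map_comp φ ψ := cmplMap_comp a φ ψ

end Literature.AlgebraicGeometry.Morphisms

end
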